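import Mathlib
import HarnessLib
import HarnessLib.Audit
import Summits.NavierStokesRegularity.Statement
import Literature.Analysis.FluidPDE.ClassicalSolution
import Literature.Analysis.FluidPDE.LerayHopf
import Literature.Analysis.FluidPDE.NSWave0
import Summits.NavierStokesRegularity.NavierStokesRegularity.Theorems.TypeICertificateLadderNoBlowupToClay
import HarnessLib.Audit.Status.Attr

/-!
Route: ReynoldsMonotone

# Route ReynoldsMonotone — less viscosity never helps — lifespan monotone in ν, plus post-Euler
regularity, gives Clay (A)

It suffices to show X = VM ∧ PostEuler (card reynolds-monotone-bad-set). VM (VISCOSITY MONOTONICITY,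
crux ViscosityMonotone):
for Schwartz-class data u₀ and 0 < ν₁ ≤ ν₂, if NS_{ν₁} from u₀ has a finite-energy classical
(BKM-class) solution living strictly
beyond time T, so does NS_{ν₂} — the lifespan T*(u₀;ν) is non-decreasing in ν ("less viscosity never
helps"; by the exact symmetry
(u₀,ν,t) ↦ (a u₀, a ν, t/a), support RayScaling, the same as: bad amplitudes on every data ray form
a terminal half-line).
PostEuler (crux PostEulerRegularity): a first singular time T of NS_ν lies strictly inside the
classical lifespan of Euler from
the same datum (viscosity never has to DESTROY an inviscid singularity at or after T_E). Glue, all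
known: Constantin1986 Thm 1.1
(Euler smooth on [0,T] ⇒ NS_ν smooth on [0,T] for ν ≤ ν₀) makes VM deliver pre-Euler regularity for
EVERY ν (crux
PreEulerRegularity, the weaker waypoint); weak–strong uniqueness continues the given solution;
NoBlowup ⇒ (A) is stmt-0055.
Lean: `(∀ (ν₁ ν₂ T : ℝ), 0 < ν₁ → ν₁ ≤ ν₂ → 0 < T → ∀ u₀ : EuclideanSpace ℝ (Fin 3) → EuclideanSpace
ℝ (Fin 3), Literature.Analysis.FluidPDE.HasRapidSpatialDecay u₀ → (∃ T' : ℝ, T < T' ∧ ∃ (v : ℝ →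
EuclideanSpace ℝ (Fin 3) → EuclideanSpace ℝ (Fin 3)) (q : ℝ → EuclideanSpace ℝ (Fin 3) → ℝ),
Literature.Analysis.FluidPDE.IsClassicalNSSolutionOn (Set.Icc 0 T') ν₁ 0 v q ∧ (∀ n : ℕ, ∃ C :
NNReal, ∀ t ∈ Set.Icc 0 T', ∫⁻ x, ‖iteratedFDeriv ℝ n (v t) x‖ₑ ^ 2 ≤ (C : ENNReal)) ∧
Literature.Analysis.FluidPDE.IsLerayHopfOn T' ν₁ 0 u₀ v ∧ v 0 = u₀) → (∃ T' : ℝ, T < T' ∧ ∃ (v : ℝ →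
EuclideanSpace ℝ (Fin 3) → EuclideanSpace ℝ (Fin 3)) (q : ℝ → EuclideanSpace ℝ (Fin 3) → ℝ),
Literature.Analysis.FluidPDE.IsClassicalNSSolutionOn (Set.Icc 0 T') ν₂ 0 v q ∧ (∀ n : ℕ, ∃ C :
NNReal, ∀ t ∈ Set.Icc 0 T', ∫⁻ x, ‖iteratedFDeriv ℝ n (v t) x‖ₑ ^ 2 ≤ (C : ENNReal)) ∧
Literature.Analysis.FluidPDE.IsLerayHopfOn T' ν₂ 0 u₀ v ∧ v 0 = u₀)) ∧ (∀ (ν T : ℝ), 0 < ν → 0 < T →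
∀ (u : ℝ → EuclideanSpace ℝ (Fin 3) → EuclideanSpace ℝ (Fin 3)) (p : ℝ → EuclideanSpace ℝ (Fin 3) →
ℝ), Literature.Analysis.FluidPDE.IsClassicalNSSolutionOn (Set.Ico 0 T) ν 0 u p →
Literature.Analysis.FluidPDE.IsLerayHopfOn T ν 0 (u 0) u →
Literature.Analysis.FluidPDE.HasRapidSpatialDecay (u 0) → ¬
Literature.Analysis.FluidPDE.HasSmoothExtensionPast ν 0 u T → ∃ (U : ℝ → EuclideanSpace ℝ (Fin 3) →
EuclideanSpace ℝ (Fin 3)) (P : ℝ → EuclideanSpace ℝ (Fin 3) → ℝ),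
Literature.Analysis.FluidPDE.IsClassicalEulerSolutionOn (Set.Icc 0 T) 0 U P ∧ (∀ n : ℕ, ∃ C :
NNReal, ∀ t ∈ Set.Icc 0 T, ∫⁻ x, ‖iteratedFDeriv ℝ n (U t) x‖ₑ ^ 2 ≤ (C : ENNReal)) ∧ U 0 = u 0)`

## Assembly
Pure logic (sorry-free in Sketch.lean, `assembly_proof`, axioms
propext/Classical.choice/Quot.sound): apply NoBlowupSuffices; fix ν,
T and a classical Leray–Hopf u on [0,T) from a rapidly decaying datum; if u had no smooth extension
past T, PostEulerRegularity
gives a BKM-class Euler solution U on [0,T] with U 0 = u 0; ConstantinSmallViscosity gives ν₀ and a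
solution beyond T at
viscosity min ν ν₀; ViscosityMonotone lifts it to ν; ClassicalContinuation then extends u past T —
contradiction.

Rationale: WHY THIS LINE. Every positive route on the board attacks (A) through a coercive or rigid object at
ONE viscosity; none asks the ORDER question
in the equation's only parameter, although both ends of the ν-axis are theorems for a fixed datum
and slab — ν ≤ ν₀(u₀,T) below
the Euler lifespan (Constantin1986 Thm 1.1, p.4 of the held text: v₀ ∈ H^{m+2}, ∫₀ᵀ‖curl v‖_∞ < ∞ ⇒
NS_ν smooth on [0,T] for
all ν ≤ ν₀, sup‖u−v‖_m ≤ Cν) and ν ≥ ν₁(u₀) (small data, FujitaKato1964 / KochTataru2001 by scaling)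
— so VM is exactly "no gap
in the good set", and VM ∧ Constantin1986 closes the whole pre-Euler regime (BardosTiti2013 Rmk:
nothing in print for
intermediate ν). Imported area: probabilistic COUPLING as the substitute for a comparison principle
NS lacks — a viscosity
increment is an average (e^{ν₂tΔ} = 𝔼 τ_{√(2(ν₂−ν₁))W_t} e^{ν₁tΔ}, Jensen), and the Constantin–Iyer
stochastic Weber
representation (ConstantinIyer2007 Thm 2.2) lets one drive NS_{ν₂} by W^{ν₁} + W^⊥ and read VM as
"conditional averaging
cannot create a singularity" up to a drift mismatch. The question is sharp because 1-D models go
both ways: Schochet1986's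
viscous Constantin–Lax–Majda equation blows up BEFORE the inviscid one ("adding diffusion makes the
solution less regular",
WegertVasudevamurthy1999 p.3), while the nonlocal-viscosity CLM model has blow-up time monotonically
increasing in ε with a
critical ε_c (WegertVasudevamurthy1999 Thm 2); diffusion-induced blow-up exists for parabolic
systems
(MizoguchiNinomiyaYanagida1998), hyper-viscosity can destroy the mechanism of global regularity
(LariosTiti2016 §5), and Hou's
interior NS scenario needed ν raised tenfold at t₀ to sustain its growth
(Hou2022PotentiallySingularNS §3 p.7). Negatives
index empty; no prior route or refuted statement concerns ν-order.

RANKED CRUXES. #0 Target (target) — X = ViscosityMonotone ∧ PostEulerRegularity (both conjuncts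
verbatim as in the two crux blocks below). (why it might fail: Either half can fail on Hou's datum:
an NS singularity before T_E kills VM (via Constantin1986), one at/after T_E kills PostEuler; and VM
has a printed 1-D counter-template (Schochet1986: viscous CLM blows up before inviscid CLM).)
[Constantin1986, Hou2022PotentiallySingularNS, Hou2022EulerInterior, Schochet1986]
#2 ViscosityMonotone (crux) — VISCOSITY MONOTONICITY (card K1). For 0 < ν₁ ≤ ν₂, T > 0 and a rapidly
decaying datum u₀: if NS_{ν₁} has a classical solution on a closed slab [0,T'] with T' > T, all L²
Sobolev norms bounded on [0,T'], Leray–Hopf from u₀, then NS_{ν₂} has such a solution on some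
[0,T''] with T'' > T. Equivalently T*(u₀;ν) is non-decreasing in ν; by RayScaling, bad amplitudes on
each data ray form a half-line [A_c,∞). [difficulty: open-problem] (why it might fail: Viscosity can
ASSIST singularity: Schochet1986's viscous CLM blows up before the inviscid one; diffusion-induced
blow-up exists (MizoguchiNinomiyaYanagida1998); Hou's scenario needs ν raised ×10 at t₀ to sustain
growth (arXiv:2107.06509 §3). One inversion T*(ν₂)<T*(ν₁) kills it.) [Schochet1986,
WegertVasudevamurthy1999, MizoguchiNinomiyaYanagida1998, Hou2022PotentiallySingularNS,
ConstantinIyer2007, LariosTiti2016]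
#3 PostEulerRegularity (crux) — POST-EULER REGULARITY (card K2, shared with card
pre-euler-time-regularity). If a classical Leray–Hopf solution of NS_ν on [0,T) from a rapidly
decaying datum admits no smooth extension past T, then Euler from the same datum has a classical
solution on the CLOSED slab [0,T] in the BKM class (all L² Sobolev norms bounded): NS singular times
lie strictly before the Euler singular time. Implied by either of two open statements (Euler
non-blow-up for Schwartz data; Clay (A) + uniqueness), weaker than both. [difficulty: open-problem]
(why it might fail: It asks viscosity to DESTROY an inviscid singularity: if Euler blows up from a
Schwartz datum (Hou2022EulerInterior, resolved to t=2.2769e-3) and NS_ν shadows it, a blow-up at T ≥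
T_E is exactly Hou's NS scenario (fit window to t=2.2868e-3, arXiv:2107.06509 §3.4.1).)
[Hou2022PotentiallySingularNS, Hou2022EulerInterior, Constantin1986, BealeKatoMajda1984,
ChenHou2025]
#4 PreEulerRegularity (crux) — PRE-EULER REGULARITY FOR EVERY VISCOSITY (the weaker waypoint; = VM ∘
Constantin1986, filed so it can also be attacked directly, e.g. by the ν-continuity method of card
pre-euler-time-regularity). If Euler from a rapidly decaying datum has a BKM-class classical
solution on [0,T], then for EVERY ν > 0 NS_ν from that datum has a BKM-class classical Leray–Hopf
solution on some [0,T'] with T' > T. [difficulty: open-problem] (why it might fail: Known only at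
the ends ν ≤ ν₀(u₀,T) (Constantin1986) and ν ≥ ν₁(u₀) (small data); a viscosity-ENHANCED stretching
episode at intermediate ν on a pre-Euler slab (Hou2022PotentiallySingularNS §3.1: viscosity
"enhances nonlinear alignment of vortex stretching") would be ¬PreEuler, hence ¬VM.)
[Constantin1986, BardosTiti2013, FujitaKato1964, Hou2022PotentiallySingularNS]
#9 ConstantinSmallViscosity (support) — Constantin 1986 Thm 1.1 in continuation currency (known; to
be vendored as a Literature named fact, then this item closes by `exact`): Euler BKM-classical on
[0,T] from a rapidly decaying datum ⇒ ∃ ν₀ > 0 such that for 0 < ν ≤ ν₀ NS_ν from that datum has a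
BKM-class classical Leray–Hopf solution on some [0,T'] ⊋ [0,T] (Thm 1.1 gives H^m smoothness on
[0,T]; BKM/Fujita–Kato continuation from time T and `IsClassicalNSSolutionOn.isLerayHopfOn` supply
T' and the Leray–Hopf clause). [difficulty: M] [Constantin1986, BealeKatoMajda1984,
MajdaBertozzi2002, FujitaKato1964]
#9 ClassicalContinuation (support) — Known composite glue: a classical Leray–Hopf solution u of NS_ν
on [0,T) from a rapidly decaying datum, plus a BKM-class classical Leray–Hopf solution v from the
same datum on a closed slab [0,T'] with T' > T, give HasSmoothExtensionPast for u (v ∈ L^∞L^∞ on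
(0,T) by Sobolev imbedding; in-tree `weak_strong_uniqueness_holds` with `IsLerayHopfOn.mono_holds`
gives u = v on [0,T); restrict v to Ico 0 T'). [difficulty: provable-now] [Prodi1959, Serrin1963,
RobinsonRodrigoSadowski2016, Leray1934]
#9 NoBlowupSuffices (support) — = stmt-NavierStokesRegularity-0055 verbatim (NoBlowup ⇒ Clay (A):
local classical Leray–Hopf theory, continuation, weak–strong gluing, energy bound,
`isNavierStokesSolution_and_smooth_iff`). [difficulty: M] [Leray1934, FujitaKato1964, Fefferman2000]
#9 PreEulerAssembly (support) — glue for the weaker waypoint (pure logic, sorry-free in Sketch.lean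
`preEulerAssembly_proof`): PreEulerRegularity → PostEulerRegularity → ClassicalContinuation →
NoBlowupSuffices → NavierStokesRegularity (by contradiction at a putative first singular time T:
PostEuler gives Euler on [0,T], PreEuler gives an NS_ν solution beyond T, ClassicalContinuation
contradicts maximality). [difficulty: provable-now] [Fefferman2000, Constantin1986]
#9 RayScaling (support) — the scaling dictionary (card P1, provable now from in-tree
`IsClassicalNSSolutionOn.stRescale` with α = a, γ = 1, β = a and `IsLerayHopfOn.viscosityRescale`):
(s,y) ↦ a·v(a s, y) carries a BKM-class classical Leray–Hopf solution of NS_ν from u₀ beyond T to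
one of NS_{aν} from a·u₀ beyond T/a. Hence VM ⇔ monotonicity of blow-up along amplitude rays, and
ν_c(u₀) := sup of bad ν is 1-homogeneous. [difficulty: provable-now] [Tao2011, Leray1934,
Fefferman2000]

TWO-LAYER PLAN. Foreseen glued splits, none filed now. ViscosityMonotone ⇐ LocalCoupling →
ContinuityClosure → ViscosityMonotone: LocalCoupling =
VM on short windows with quantitative loss (two-viscosity Constantin–Iyer coupling W^{ν₂} = W^{ν₁} +
W^⊥, conditional Jensen for
translation-invariant convex functionals, drift-mismatch error; needs restarts since
ConstantinIyer2007 Thm 2.2 is local),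
ContinuityClosure = the good ν-set for (u₀,T) is open (stability) and closed from LocalCoupling.
PostEulerRegularity ⇐ (Euler
non-blow-up for Schwartz data) is a one-line child if someone wants to stake it; otherwise its
children live in the Type-II /
inviscid-relaxation routes. If PreEulerRegularity closes directly, PreEulerAssembly replaces the
main assembly (VM then unstaffed
but kept as the card's question). Definition requests deferred to that stage: `lifespan ν u₀ :
WithTop ℝ`, `criticalViscosity u₀`.

KILL CRITERIA. ¬ViscosityMonotone proved (one rigorous inversion T*(u₀;ν₂) < T*(u₀;ν₁), ν₁ < ν₂)
refutes the card's thesis: if the witness is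
singular on a pre-Euler slab it also refutes PreEulerRegularity and (A) itself — close
`refuted:ViscosityMonotone` and hand the
witness to the Blowup route; if VM fails only through lifespans both beyond T_E, restate rank 2 as
PreEulerRegularity (pivot to the
waypoint thesis, PreEulerAssembly). ¬PostEulerRegularity or ¬PreEulerRegularity are ¬NoBlowup, i.e.
¬(A): close and record.
NoBlowup (stmt-NavierStokesRegularity-0054) proved elsewhere moots the route. A certified
non-monotone instance of the dyadic toy (parked, see NOT DECOMPOSED YET) is NOT a kill (toy), but
VM loses its cheapest support and drops below PostEuler in rank.

NOT DECOMPOSED YET. The coupling lemma itself (card K3): the tree has no stochastic-Lagrangian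
vocabulary beyond `AdaptedBackwardKernel` (a PDE
surrogate of Constantin–Iyer), and the drift-mismatch control is a large-data stability estimate of
the strength of the conclusion
— it becomes LocalCoupling only after a prover engages VM. The critical-viscosity functional ν_c,
its semicontinuity and the Baire
dichotomy on the direction sphere (card P3) are consequences, not load-bearing. ¬VM is not filed as
a separate item (refuters
take ¬ViscosityMonotone on the crux; its realistic habitat is numerics). Euler continuation/BKM
bookkeeping stays inside
ConstantinSmallViscosity; the L^∞ bound of the strong solution stays inside ClassicalContinuation.
PARKED by the cone
repair (rev 4): the toy VM item DyadicMonotone (Cheskidov dyadic model, blow-up currency of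
Cheskidov2008 Thm 5.3: if the
ν₂-solution has ∫₀ᵀ‖u‖³_{1/3+γ} = ∞ so does every ν₁-solution from the same non-negative datum, ν₁ ≤
ν₂) was dropped because its
only vocabulary (`Dyadic.IsCheskidovSolution`, `Dyadic.dyadicNormSq`) lives in the barrier module
DyadicCascadeRegularity, whose
named fact the cone census still counts unproved (the theorem `dyadicCascadeRegularity_holds`
exists); it is not load-bearing
(refuter g41-13 found the truncated toy numerically monotone in ν) and is re-added by `workitem add`
once that census entry clears.
The BKM class is written out by definition in every item (`∀ n, ∃ C, ∀ t ∈ S, ∫⁻ x, ‖iteratedFDeriv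
ℝ n (v t) x‖ₑ ^ 2 ≤ C` is
`Literature.Analysis.FluidPDE.HasBoundedSobolevNormsOn S v` of NSVorticity.lean verbatim) so that
the route no longer imports
NSVorticity and its unproved/refuted facts (isVorticitySolutionOn_iff, constantin_fefferman,
IsVorticitySolutionOn.exists_pressure);
provers fold/unfold it freely. Remaining import-borne cone debt, used by no item: needs-fact
Literature.Analysis.FluidPDE.Torus.IsLerayHopfOn.mono (torus twin of the proved
`IsLerayHopfOn.mono_holds`; LerayHopf.lean must stay
for `IsLerayHopfOn`).

CHEAPEST FALSIFIER. (1) The toy: integrate Cheskidov's dyadic model (λ = 2, α = 0.3 < 1/3, N ≈ 30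
shells, non-negative datum above the Thm 5.3
threshold) at ν and 2ν with interval arithmetic and compare the blow-up indicator ∫‖u‖³_{1/3+γ}; a
certified inversion retires
VM's toy support in a day (refuter g41-13's RK4 probe at λ = 2, α = 1/4, N = 16 found the
cascade-front time increasing in ν for
all data tried). (2) Literature: the explicit solution of Schochet1986 (paywalled, acq-01751 filed)
— is the viscous-CLM
blow-up time non-monotone among ε > 0, or only below the inviscid time? The former is a printed ¬VM
template with the right
endpoint structure. (3) Numerics at constant ν on Hou's Case-1 datum (arXiv:2107.06509 §3): Hou
reports sustained growth only
after raising ν from 5e-4 to 5e-3 at t₀ = 0.00227375, but no same-datum constant-ν comparison is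
printed (Case 4 is a different
datum) — one sweep ν ∈ {5e-4, 1e-3, 5e-3} with sup|ω(t)| compared at equal times decides the sign VM
predicts. Not run here
(plancard seat, no kit).

NUMBERS. Constantin1986 Thm 1.1: ν₀ = ν₀(T, ‖v₀‖_{m+2}, ∫₀ᵀ‖curl v‖_∞), sup_{[0,T]}‖u^ν − v‖_m ≤ Cν.
Large-ν end: global for
‖u₀‖_{Ḣ^{1/2}} ≤ cν (FujitaKato1964) / ‖u₀‖_{BMO⁻¹} ≤ cν (KochTataru2001).
Hou2022PotentiallySingularNS: ν = 5·10⁻⁴ on [0,t₀],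
t₀ = 0.00227375, then 5·10⁻³; ‖ω‖_∞ ×10⁷ by t₄ = 0.0022868502; constant-ν Case 4: ×2078 after 3·10⁵
steps vs ×4.186·10⁶
(Case 1); Hou2022EulerInterior resolved to t = 0.002276938. Cheskidov2008: blow-up for α < 1/3 (Thm
5.3, in tree
`Cheskidov2008_thm53_holds`), global strong for α ≥ 1/2 (Thm 4.4); BarbatoMorandinRomito2011:
regular for β ∈ (2,5/2].
WegertVasudevamurthy1999 Thm 2: T(ε) increasing, T = ∞ for ε ≥ ε_c(ω₀). Items at open: 11 (3 cruxes,
1 target, 6 support,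
1 assembly); after the cone repair (rev 4): 10 (3 cruxes, 1 target, 5 support, 1 assembly).

DEFINITION REQUESTS. None (RegularUpTo and, since rev 4, the BKM class HasBoundedSobolevNormsOn are
inlined; IsClassicalEulerSolutionOn,
HasSmoothExtensionPast, IsLerayHopfOn exist). Cite fact wanted (filed after open): Constantin1986
Thm 1.1 as a named fact
`Literature.Analysis.FluidPDE.constantin_small_viscosity` (Euler v₀ ∈ H^{m+2}, ∫₀ᵀ‖curl v‖_∞ < ∞ ⇒
∃ν₀ ∀ν ≤ ν₀: NS_ν ∈
C([0,T];H^m), sup‖u−v‖_m ≤ Cν), which closes ConstantinSmallViscosity up to continuation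
bookkeeping.

Novelty: Searches (2026-08-15): `lit frontier NavierStokesRegularity --since 2022` (30; none on ν-dependence
of the lifespan; Hou2026 = generalized viscosity); `lit bridges --cross any` (30; surveys); crossref
"loss of regularity viscosity Euler NS same data" (10; LariosTiti2016), "Constantin-Lax-Majda
viscosity blow-up" (10: Schochet1986, WegertVasudevamurthy1999, Sakajo2003), Ishige/Mizoguchi
(MizoguchiNinomiyaYanagida1998, IshigeYagisita2005, FujishimaIshige2010); zbmath "blow-up time
viscosity monotone" (0); `lit galaxy search --star all` "monotone in the viscosity" (0), "larger
viscosity blows up" (0), "diffusion-induced blowup" (2); `lit read` doi:10.1007/bf01211598 pp.4–5,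
arXiv:2107.06509 pp.7–16, arXiv:2107.05870 pp.12–13, doi:10.4171/zaa/876 pp.3–8, arXiv:1401.1534
p.12.
Nearest prior art found: Constantin1986 Thm 1.1 (small-ν end of VM/PreEuler);
WegertVasudevamurthy1999 Thm 2 (blow-up time monotone in a nonlocal viscosity with threshold, 1-D
CLM = shape of VM + ν_c) vs Schochet1986 (counter-template); scalar diffusion-induced blow-up
(MizoguchiNinomiyaYanagida1998, IshigeYagisita2005); Hou2022PotentiallySingularNS §3; card
pre-euler-time-regularity (ν-UNIFORM bound).
Delta: ORDER in ν instead of uniformity — a monotonicity principle for the 3-D NS lifespan from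
Schwartz data (ray dictionary, critical viscosity), a two-viscosity Constantin–Iyer coupling to
prove it, and Clay (A) ⇐ VM ∧ PostEuler via Constantin1986; none found stated for NS.
Claimed grade: new-combination  [refs: 10.1007/bf01211598, 10.4171/zaa/876, 2107.06509, 2107.05870, 1401.1534, doi:10.1007/bf01211598, doi:10.4171/zaa/876, Hou2026, LariosTiti2016, Schochet1986, WegertVasudevamurthy1999, Sakajo2003, MizoguchiNinomiyaYanagida1998, IshigeYagisita2005, FujishimaIshige2010, Constantin1986]

Barriers (technique_class: viscosity-order, stochastic-coupling, inviscid-comparison): - technique_class: viscosity-order, stochastic-coupling, inviscid-comparison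
- Literature.Barriers.NavierStokesRegularity.EnergySupercriticality: VM/PostEuler are ORDER
statements between two equations from one datum with no coercive quantity, so the scaling count does
not apply as posed; it bites a coupling proof of VM via the drift-mismatch term — conceded; the bet:
pathwise coupling + convexity needs less than a norm bound.
- Literature.Barriers.NavierStokesRegularity.TaoAveragedBlowup: the coupling uses exact
Lagrangian/Kelvin transport (Constantin–Iyer Weber formula), absent from averaged bilinear forms —
not an abstract energy argument; VM is untested for the averaged equation (its blow-up needs
ν-adapted data) — orthogonal.
- Literature.Barriers.NavierStokesRegularity.DyadicCascadeRegularity: about blow-up AT 3-D scaling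
(β ∈ (2,5/2]) of a cascade; no item uses a cascade model (the heuristic dyadic toy, Cheskidov α <
1/3, is parked since rev 4) — not engaged.
- Literature.Barriers.NavierStokesRegularity.AxisymmetricTypeIExclusion: shapes a ¬VM/¬PostEuler
witness on Hou's axisymmetric datum (must be Type II), not the positive cruxes.
- Literature.Barriers.NavierStokesRegularity.CriticalNormBlowupNecessity: constrains witnesses (L³ ↑
∞ at an inversion's singular time); not engaged.
- Literature.Barriers.NavierStokesRegularity.LionsExponentSharpness: about changing the dissipation
OPERATOR; VM varies only the coefficient.
- Negatives index: empty at filing (2026-08-15).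

History (route lifecycle, newest last):
- 2026-08-15T16:15:02Z · rev 4: restated Target (stmt-NavierStokesRegularity-8673), ViscosityMonotone (stmt-NavierStokesRegularity-8674), PostEulerRegularity (stmt-NavierStokesRegularity-8675), PreEulerRegularity (stmt-NavierStokesRegularity-8676), ConstantinSmallViscosity (stmt-NavierStokesRegularity-8677), ClassicalContinuation (stmt-NavierS (planner-rrepair-NavierStokesRegularity-Reynold-f44bb940-g2-0)
- 2026-08-15T16:15:02Z · rev 4: dropped DyadicMonotone — route-repair (cone, g2, unit rrepair-NavierStokesRegularity-Reynold-f44bb940-g2): REROUTED — imports := ClassicalSolution, LerayHopf, NSWave0 (dropped: Literatu (planner-rrepair-NavierStokesRegularity-Reynold-f44bb940-g2-0)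

sub-problem: NavierStokesRegularity · status: done · opened planner-plancard-NavierStokesRegularity-Navie-eeff9292-0 2026-08-15T13:27:08Z · rev 5 · ledger route-NavierStokesRegularity-ReynoldsMonotone
GENERATED by the gate from the ledger (D-0016/17). Provers cite these decls: `theorem foo : Summit.NavierStokesRegularity.NavierStokesRegularity.Theses.ReynoldsMonotone.<Decl> := …` in Summits/NavierStokesRegularity/NavierStokesRegularity/Theorems/<Name>.lean.
-/

namespace Summit.NavierStokesRegularity.NavierStokesRegularity.Theses.ReynoldsMonotone

open scoped BigOperators Topology Manifold Classical MeasureTheory ProbabilityTheory Matrix InnerProductSpace ComplexConjugate ContinuousMap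
open Filter Set Function TopologicalSpace MeasureTheory

attribute [summit_statement] _root_.NavierStokesRegularity

open Literature.NS

-- earlier Target (stmt-NavierStokesRegularity-8673, replaced 2026-08-15T16:15:02Z -> stmt-NavierStokesRegularity-10422): retired by None — (∀ (ν₁ ν₂ T : ℝ), 0 < ν₁ → ν₁ ≤ ν₂ → 0 < T → ∀ u₀ : EuclideanSpace ℝ (Fin 3) → EuclideanSpace ℝ (Fin 3), Literature.Analysis.FluidPDE.HasRapidSpatialDecay u₀ → (∃ T' : ℝ, T < T' ∧ ∃ (v : ℝ → EuclideanSpace ℝ (Fin 3) → EuclideanSpace ℝ (Fin 3)) (q : ℝ → EuclideanS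
/-- item stmt-NavierStokesRegularity-10422 · target · rank 0 · open · by planner
why it might fail: Either conjunct can fail on Hou's datum: an NS_ν singularity before T_Euler kills VM (via Constantin1986 Thm 1.1); one at/after T_Euler kills PostEuler (Hou's NS growth runs to t=2.2868e-3 > T_E≈2.2769e-3); VM has a printed 1-D counter-template (Schochet1986: viscous CLM blows up at T<T₀).
sources: Constantin1986, Constantin2007, Hou2022PotentiallySingularNS, Hou2022EulerInterior, arXiv:2107.06509, Schochet1986
[target] X = ViscosityMonotone ∧ PostEulerRegularity (both conjuncts verbatim as in the two crux
blocks below). [rev 4 cone repair: the BKM-class clause `∀ n, ∃ C, ∀ t ∈ S, ∫⁻ x, ‖iteratedFDeriv ℝ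
n (v t) x‖ₑ ^ 2 ≤ C` is, by definition, `Literature.Analysis.FluidPDE.HasBoundedSobolevNormsOn S v`
(NSVorticity.lean) written out so that the route does not import that module; fold/unfold it freely
(Iff.rfl).] -/
@[route_item "route-NavierStokesRegularity-ReynoldsMonotone"]
def Target : Prop :=
  (∀ (ν₁ ν₂ T : ℝ), 0 < ν₁ → ν₁ ≤ ν₂ → 0 < T → ∀ u₀ : EuclideanSpace ℝ (Fin 3) → EuclideanSpace ℝ (Fin 3), Literature.Analysis.FluidPDE.HasRapidSpatialDecay u₀ → (∃ T' : ℝ, T < T' ∧ ∃ (v : ℝ → EuclideanSpace ℝ (Fin 3) → EuclideanSpace ℝ (Fin 3)) (q : ℝ → EuclideanSpace ℝ (Fin 3) → ℝ), Literature.Analysis.FluidPDE.IsClassicalNSSolutionOn (Set.Icc 0 T') ν₁ 0 v q ∧ (∀ n : ℕ, ∃ C : NNReal, ∀ t ∈ Set.Icc 0 T', ∫⁻ x, ‖iteratedFDeriv ℝ n (v t) x‖ₑ ^ 2 ≤ (C : ENNReal)) ∧ Literature.Analysis.FluidPDE.IsLerayHopfOn T' ν₁ 0 u₀ v ∧ v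 0 = u₀) → (∃ T' : ℝ, T < T' ∧ ∃ (v : ℝ → EuclideanSpace ℝ (Fin 3) → EuclideanSpace ℝ (Fin 3)) (q : ℝ → EuclideanSpace ℝ (Fin 3) → ℝ), Literature.Analysis.FluidPDE.IsClassicalNSSolutionOn (Set.Icc 0 T') ν₂ 0 v q ∧ (∀ n : ℕ, ∃ C : NNReal, ∀ t ∈ Set.Icc 0 T', ∫⁻ x, ‖iteratedFDeriv ℝ n (v t) x‖ₑ ^ 2 ≤ (C : ENNReal)) ∧ Literature.Analysis.FluidPDE.IsLerayHopfOn T' ν₂ 0 u₀ v ∧ v 0 = u₀)) ∧ (∀ (ν T : ℝ), 0 < ν → 0 < T → ∀ (u : ℝ → EuclideanSpace ℝ (Fin 3) → EuclideanSpace ℝ (Fin 3)) (p : ℝ → EuclideanSpace ℝ (Fin 3) → ℝ), Literature.Analysis.FluidPDE.IsClassicalNSSolutionOn (Set.Ico 0 T) ν 0 u p → Literature.Analysis.FluidPDE.IsLerayHopfOn T ν 0 (u 0) u → Literature.Analysis.FluidPDE.HasRapidSpatialDecay (u 0) → ¬ Literature.Analysis.FluidPDE.HasSmoothExtensionPast ν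 0 u T → ∃ (U : ℝ → EuclideanSpace ℝ (Fin 3) → EuclideanSpace ℝ (Fin 3)) (P : ℝ → EuclideanSpace ℝ (Fin 3) → ℝ), Literature.Analysis.FluidPDE.IsClassicalEulerSolutionOn (Set.Icc 0 T) 0 U P ∧ (∀ n : ℕ, ∃ C : NNReal, ∀ t ∈ Set.Icc 0 T, ∫⁻ x, ‖iteratedFDeriv ℝ n (U t) x‖ₑ ^ 2 ≤ (C : ENNReal)) ∧ U 0 = u 0)

-- earlier ViscosityMonotone (stmt-NavierStokesRegularity-8674, replaced 2026-08-15T16:15:02Z -> stmt-NavierStokesRegularity-10423): retired by None — ∀ (ν₁ ν₂ T : ℝ), 0 < ν₁ → ν₁ ≤ ν₂ → 0 < T → ∀ u₀ : EuclideanSpace ℝ (Fin 3) → EuclideanSpace ℝ (Fin 3), Literature.Analysis.FluidPDE.HasRapidSpatialDecay u₀ → (∃ T' : ℝ, T < T' ∧ ∃ (v : ℝ → EuclideanSpace ℝ (Fin 3) → EuclideanSpace ℝ (Fin 3)) (q : ℝ → 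
/-- item stmt-NavierStokesRegularity-10423 · crux · rank 2 · open · by planner
why it might fail: Viscosity can ASSIST blow-up: Schochet1986's viscous CLM blows up at T<T₀, the inviscid time (doi:10.4171/zaa/876 p.3); diffusion-induced blow-up exists (MizoguchiNinomiyaYanagida1998); Hou must raise ν 5e-4→5e-3 at t₀ to sustain growth (arXiv:2107.06509 p.7). One inversion T*(ν₂)<T*(ν₁) kills it.
sources: Schochet1986, WegertVasudevamurthy1999, MizoguchiNinomiyaYanagida1998, Hou2022PotentiallySingularNS, arXiv:2107.06509, Constantin1986
[crux] VISCOSITY MONOTONICITY (card K1). For 0 < ν₁ ≤ ν₂, T > 0 and a rapidly decaying datum u₀: if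
NS_{ν₁} has a classical solution on a closed slab [0,T'] with T' > T, all L² Sobolev norms bounded
on [0,T'], Leray–Hopf from u₀, then NS_{ν₂} has such a solution on some [0,T''] with T'' > T.
Equivalently T*(u₀;ν) is non-decreasing in ν; by RayScaling, bad amplitudes on each data ray form a
half-line [A_c,∞). [difficulty: open-problem] [rev 4 cone repair: the BKM-class clause `∀ n, ∃ C, ∀
t ∈ S, ∫⁻ x, ‖iteratedFDeriv ℝ n (v t) x‖ₑ ^ 2 ≤ C` is, by definition,
`Literature.Analysis.FluidPDE.HasBoundedSobolevNormsOn S v` (NSVorticity.lean) written out so that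
the route does not import that module; fold/unfold it freely (Iff.rfl).] -/
@[route_item "route-NavierStokesRegularity-ReynoldsMonotone", crux]
def ViscosityMonotone : Prop :=
  ∀ (ν₁ ν₂ T : ℝ), 0 < ν₁ → ν₁ ≤ ν₂ → 0 < T → ∀ u₀ : EuclideanSpace ℝ (Fin 3) → EuclideanSpace ℝ (Fin 3), Literature.Analysis.FluidPDE.HasRapidSpatialDecay u₀ → (∃ T' : ℝ, T < T' ∧ ∃ (v : ℝ → EuclideanSpace ℝ (Fin 3) → EuclideanSpace ℝ (Fin 3)) (q : ℝ → EuclideanSpace ℝ (Fin 3) → ℝ), Literature.Analysis.FluidPDE.IsClassicalNSSolutionOn (Set.Icc 0 T') ν₁ 0 v q ∧ (∀ n : ℕ, ∃ C : NNReal, ∀ t ∈ Set.Icc 0 T', ∫⁻ x, ‖iteratedFDeriv ℝ n (v t) x‖ₑ ^ 2 ≤ (C : ENNReal)) ∧ Literature.Analysis.FluidPDE.IsLerayHopfOn T' ν₁ 0 u₀ v ∧ v 0 = u₀) → (∃ T' : ℝ, T < T' ∧ ∃ (v : ℝ → EuclideanSpace ℝ (Fin 3) → EuclideanSpace ℝ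 (Fin 3)) (q : ℝ → EuclideanSpace ℝ (Fin 3) → ℝ), Literature.Analysis.FluidPDE.IsClassicalNSSolutionOn (Set.Icc 0 T') ν₂ 0 v q ∧ (∀ n : ℕ, ∃ C : NNReal, ∀ t ∈ Set.Icc 0 T', ∫⁻ x, ‖iteratedFDeriv ℝ n (v t) x‖ₑ ^ 2 ≤ (C : ENNReal)) ∧ Literature.Analysis.FluidPDE.IsLerayHopfOn T' ν₂ 0 u₀ v ∧ v 0 = u₀)

-- earlier PostEulerRegularity (stmt-NavierStokesRegularity-8675, replaced 2026-08-15T16:15:02Z -> stmt-NavierStokesRegularity-10424): retired by None — ∀ (ν T : ℝ), 0 < ν → 0 < T → ∀ (u : ℝ → EuclideanSpace ℝ (Fin 3) → EuclideanSpace ℝ (Fin 3)) (p : ℝ → EuclideanSpace ℝ (Fin 3) → ℝ), Literature.Analysis.FluidPDE.IsClassicalNSSolutionOn (Set.Ico 0 T) ν 0 u p → Literature.Analysis.FluidPDE.IsLerayHopf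
/-- item stmt-NavierStokesRegularity-10424 · crux · rank 3 · open · by planner
why it might fail: It forbids an NS singularity at/after the Euler time: if Euler blows up from a Schwartz datum (Hou2022EulerInterior, T_E≈2.2769e-3) and NS_ν shadows it to a blow-up at T≥T_E — exactly Hou's NS scenario (arXiv:2107.06509 §3: ‖ω‖_∞ ×10⁷ by t=2.2868e-3 > T_E) — PostEuler is false.
sources: Hou2022PotentiallySingularNS, Hou2022EulerInterior, arXiv:2107.06509, arXiv:2107.05870, Constantin1986, Constantin2007
[crux] POST-EULER REGULARITY (card K2, shared with card pre-euler-time-regularity). If a classical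
Leray–Hopf solution of NS_ν on [0,T) from a rapidly decaying datum admits no smooth extension past
T, then Euler from the same datum has a classical solution on the CLOSED slab [0,T] in the BKM class
(all L² Sobolev norms bounded): NS singular times lie strictly before the Euler singular time.
Implied by either of two open statements (Euler non-blow-up for Schwartz data; Clay (A) +
uniqueness), weaker than both. [difficulty: open-problem] [rev 4 cone repair: the BKM-class clause
`∀ n, ∃ C, ∀ t ∈ S, ∫⁻ x, ‖iteratedFDeriv ℝ n (v t) x‖ₑ ^ 2 ≤ C` is, by definition,
`Literature.Analysis.FluidPDE.HasBoundedSobolevNormsOn S v` (NSVorticity.lean) written out so that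
the route does not import that module; fold/unfold it freely (Iff.rfl).] -/
@[route_item "route-NavierStokesRegularity-ReynoldsMonotone", crux]
def PostEulerRegularity : Prop :=
  ∀ (ν T : ℝ), 0 < ν → 0 < T → ∀ (u : ℝ → EuclideanSpace ℝ (Fin 3) → EuclideanSpace ℝ (Fin 3)) (p : ℝ → EuclideanSpace ℝ (Fin 3) → ℝ), Literature.Analysis.FluidPDE.IsClassicalNSSolutionOn (Set.Ico 0 T) ν 0 u p → Literature.Analysis.FluidPDE.IsLerayHopfOn T ν 0 (u 0) u → Literature.Analysis.FluidPDE.HasRapidSpatialDecay (u 0) → ¬ Literature.Analysis.FluidPDE.HasSmoothExtensionPast ν 0 u T → ∃ (U : ℝ → EuclideanSpace ℝ (Fin 3) → EuclideanSpace ℝ (Fin 3)) (P : ℝ → EuclideanSpace ℝ (Fin 3) → ℝ), Literature.Analysis.FluidPDE.IsClassicalEulerSolutionOn (Set.Icc 0 T) 0 U P ∧ (∀ n : ℕ, ∃ C : NNReal, ∀ t ∈ Set.Icc 0 T, ∫⁻ x, ‖iteratedFDeriv ℝ n (U t) x‖ₑ ^ 2 ≤ (C : ENNReal)) ∧ U 0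 = u 0

-- earlier PreEulerRegularity (stmt-NavierStokesRegularity-8676, replaced 2026-08-15T16:15:02Z -> stmt-NavierStokesRegularity-10425): retired by None — ∀ T : ℝ, 0 < T → ∀ (U : ℝ → EuclideanSpace ℝ (Fin 3) → EuclideanSpace ℝ (Fin 3)) (P : ℝ → EuclideanSpace ℝ (Fin 3) → ℝ), Literature.Analysis.FluidPDE.IsClassicalEulerSolutionOn (Set.Icc 0 T) 0 U P → Literature.Analysis.FluidPDE.HasBoundedSobolevNormsO
/-- item stmt-NavierStokesRegularity-10425 · crux · rank 4 · open · by planner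
why it might fail: Known only at the ends ν≤ν₀(T,‖u₀‖_{m+2},∫‖curl v‖_∞) (Constantin1986 Thm 1.1) and ν≥ν₁(u₀) (small data). Constantin2007 p.606: 'a gap between the two ranges of viscosities … not clear how to close it'. One viscosity-enhanced stretching episode at middle ν before T_E (2107.06509 p.9) is ¬PreEuler.
sources: Constantin1986, doi:10.1007/bf01211598, Constantin2007, BardosTiti2013, FujitaKato1964, KochTataru2001
[crux] PRE-EULER REGULARITY FOR EVERY VISCOSITY (the weaker waypoint; = VM ∘ Constantin1986, filed
so it can also be attacked directly, e.g. by the ν-continuity method of card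
pre-euler-time-regularity). If Euler from a rapidly decaying datum has a BKM-class classical
solution on [0,T], then for EVERY ν > 0 NS_ν from that datum has a BKM-class classical Leray–Hopf
solution on some [0,T'] with T' > T. [difficulty: open-problem] [rev 4 cone repair: the BKM-class
clause `∀ n, ∃ C, ∀ t ∈ S, ∫⁻ x, ‖iteratedFDeriv ℝ n (v t) x‖ₑ ^ 2 ≤ C` is, by definition,
`Literature.Analysis.FluidPDE.HasBoundedSobolevNormsOn S v` (NSVorticity.lean) written out so that
the route does not import that module; fold/unfold it freely (Iff.rfl).] -/
@[route_item "route-NavierStokesRegularity-ReynoldsMonotone"]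
def PreEulerRegularity : Prop :=
  ∀ T : ℝ, 0 < T → ∀ (U : ℝ → EuclideanSpace ℝ (Fin 3) → EuclideanSpace ℝ (Fin 3)) (P : ℝ → EuclideanSpace ℝ (Fin 3) → ℝ), Literature.Analysis.FluidPDE.IsClassicalEulerSolutionOn (Set.Icc 0 T) 0 U P → (∀ n : ℕ, ∃ C : NNReal, ∀ t ∈ Set.Icc 0 T, ∫⁻ x, ‖iteratedFDeriv ℝ n (U t) x‖ₑ ^ 2 ≤ (C : ENNReal)) → Literature.Analysis.FluidPDE.HasRapidSpatialDecay (U 0) → ∀ ν : ℝ, 0 < ν → ∃ T' : ℝ, T < T' ∧ ∃ (v : ℝ → EuclideanSpace ℝ (Fin 3) → EuclideanSpace ℝ (Fin 3)) (q : ℝ → EuclideanSpace ℝ (Fin 3) → ℝ), Literature.Analysis.FluidPDE.IsClassicalNSSolutionOn (Set.Icc 0 T') ν 0 v q ∧ (∀ n : ℕ, ∃ C : NNReal, ∀ t ∈ Set.Icc 0 T', ∫⁻ x, ‖iteratedFDeriv ℝ n (v t) x‖ₑ ^ 2 ≤ (C : ENNReal)) ∧ Literature.Analysis.FluidPDE.IsLerayHopfOn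 T' ν 0 (U 0) v ∧ v 0 = U 0

/-- item stmt-NavierStokesRegularity-0055 · support · rank 9 · closed · proved by Summit.NavierStokesRegularity.NavierStokesRegularity.Theorems.typeICertificateLadder_noBlowupToClay_proof @ 8d57e70af7e2 (prover) · by planner
sources: Leray1934, FujitaKato1964, Fefferman2000
Given NoBlowup, build the Clay (A) solution: local finite-energy classical solution for smooth
divergence-free rapidly decaying data (Leray 1934 §III / Fujita–Kato 1964 + LPS smoothing), continue
past every T using NoBlowup, glue by weak–strong uniqueness (Prodi–Serrin), bounded energy from the
energy inequality, and convert with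
Literature.Analysis.FluidPDE.isNavierStokesSolution_and_smooth_iff. Blow-up at spatial infinity is
excluded by CKN ε-regularity applied far out. May take named Literature facts (leray_existence_R3,
ladyzhenskaya_prodi_serrin, weak_strong_uniqueness, fujita_kato_local) as hypotheses if the grounder
so rules. -/
@[route_item "route-NavierStokesRegularity-ReynoldsMonotone", crux]
def NoBlowupSuffices : Prop :=
  (∀ (ν T : ℝ), 0 < ν → 0 < T → ∀ (u : ℝ → EuclideanSpace ℝ (Fin 3) → EuclideanSpace ℝ (Fin 3)) (p : ℝ → EuclideanSpace ℝ (Fin 3) → ℝ), Literature.Analysis.FluidPDE.IsClassicalNSSolutionOn (Set.Ico 0 T) ν 0 u p → Literature.Analysis.FluidPDE.IsLerayHopfOn T ν 0 (u 0) u → Literature.Analysis.FluidPDE.HasRapidSpatialDecay (u 0) → Literature.Analysis.FluidPDE.HasSmoothExtensionPast ν 0 u T) → NavierStokesRegularity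

/-- `NoBlowupSuffices` holds: proved by `Summit.NavierStokesRegularity.NavierStokesRegularity.Theorems.typeICertificateLadder_noBlowupToClay_proof` @ 8d57e70af7e2. -/
theorem NoBlowupSuffices_holds : NoBlowupSuffices := _root_.Summit.NavierStokesRegularity.NavierStokesRegularity.Theorems.typeICertificateLadder_noBlowupToClay_proof

-- earlier ConstantinSmallViscosity (stmt-NavierStokesRegularity-8677, replaced 2026-08-15T16:15:02Z -> stmt-NavierStokesRegularity-10426): retired by None — ∀ T : ℝ, 0 < T → ∀ (U : ℝ → EuclideanSpace ℝ (Fin 3) → EuclideanSpace ℝ (Fin 3)) (P : ℝ → EuclideanSpace ℝ (Fin 3) → ℝ), Literature.Analysis.FluidPDE.IsClassicalEulerSolutionOn (Set.Icc 0 T) 0 U P → Literature.Analysis.FluidPDE.HasBoundedSobolev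
/-- item stmt-NavierStokesRegularity-10426 · support · rank 9 · open · by planner
sources: Constantin1986, BealeKatoMajda1984, MajdaBertozzi2002, FujitaKato1964
[support] Constantin 1986 Thm 1.1 in continuation currency (known; to be vendored as a Literature
named fact, then this item closes by `exact`): Euler BKM-classical on [0,T] from a rapidly decaying
datum ⇒ ∃ ν₀ > 0 such that for 0 < ν ≤ ν₀ NS_ν from that datum has a BKM-class classical Leray–Hopf
solution on some [0,T'] ⊋ [0,T] (Thm 1.1 gives H^m smoothness on [0,T]; BKM/Fujita–Kato continuation
from time T and `IsClassicalNSSolutionOn.isLerayHopfOn` supply T' and the Leray–Hopf clause).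
[difficulty: M] [rev 4 cone repair: the BKM-class clause `∀ n, ∃ C, ∀ t ∈ S, ∫⁻ x, ‖iteratedFDeriv ℝ
n (v t) x‖ₑ ^ 2 ≤ C` is, by definition, `Literature.Analysis.FluidPDE.HasBoundedSobolevNormsOn S v`
(NSVorticity.lean) written out so that the route does not import that module; fold/unfold it freely
(Iff.rfl).] -/
@[route_item "route-NavierStokesRegularity-ReynoldsMonotone", crux]
def ConstantinSmallViscosity : Prop :=
  ∀ T : ℝ, 0 < T → ∀ (U : ℝ → EuclideanSpace ℝ (Fin 3) → EuclideanSpace ℝ (Fin 3)) (P : ℝ → EuclideanSpace ℝ (Fin 3) → ℝ), Literature.Analysis.FluidPDE.IsClassicalEulerSolutionOn (Set.Icc 0 T) 0 U P → (∀ n : ℕ, ∃ C : NNReal, ∀ t ∈ Set.Icc 0 T, ∫⁻ x, ‖iteratedFDeriv ℝ n (U t) x‖ₑ ^ 2 ≤ (C : ENNReal)) → Literature.Analysis.FluidPDE.HasRapidSpatialDecay (U 0) → ∃ ν₀ : ℝ, 0 < ν₀ ∧ ∀ ν : ℝ, 0 < ν → ν ≤ ν₀ → ∃ T' : ℝ,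 T < T' ∧ ∃ (v : ℝ → EuclideanSpace ℝ (Fin 3) → EuclideanSpace ℝ (Fin 3)) (q : ℝ → EuclideanSpace ℝ (Fin 3) → ℝ), Literature.Analysis.FluidPDE.IsClassicalNSSolutionOn (Set.Icc 0 T') ν 0 v q ∧ (∀ n : ℕ, ∃ C : NNReal, ∀ t ∈ Set.Icc 0 T', ∫⁻ x, ‖iteratedFDeriv ℝ n (v t) x‖ₑ ^ 2 ≤ (C : ENNReal)) ∧ Literature.Analysis.FluidPDE.IsLerayHopfOn T' ν 0 (U 0) v ∧ v 0 = U 0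

-- earlier ClassicalContinuation (stmt-NavierStokesRegularity-8678, replaced 2026-08-15T16:15:02Z -> stmt-NavierStokesRegularity-10427): retired by None — ∀ (ν T : ℝ), 0 < ν → 0 < T → ∀ (u : ℝ → EuclideanSpace ℝ (Fin 3) → EuclideanSpace ℝ (Fin 3)) (p : ℝ → EuclideanSpace ℝ (Fin 3) → ℝ), Literature.Analysis.FluidPDE.IsClassicalNSSolutionOn (Set.Ico 0 T) ν 0 u p → Literature.Analysis.FluidPDE.IsLerayHo
/-- item stmt-NavierStokesRegularity-10427 · support · rank 9 · closed · proved by Summit.NavierStokesRegularity.NavierStokesRegularity.Theorems.reynoldsMonotone_classicalContinuation_proof (prover) · by planner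
sources: Prodi1959, Serrin1963, RobinsonRodrigoSadowski2016, Leray1934
[support] Known composite glue: a classical Leray–Hopf solution u of NS_ν on [0,T) from a rapidly
decaying datum, plus a BKM-class classical Leray–Hopf solution v from the same datum on a closed
slab [0,T'] with T' > T, give HasSmoothExtensionPast for u (v ∈ L^∞L^∞ on (0,T) by Sobolev
imbedding; in-tree `weak_strong_uniqueness_holds` with `IsLerayHopfOn.mono_holds` gives u = v on
[0,T); restrict v to Ico 0 T'). [difficulty: provable-now] [rev 4 cone repair: the BKM-class clause
`∀ n, ∃ C, ∀ t ∈ S, ∫⁻ x, ‖iteratedFDeriv ℝ n (v t) x‖ₑ ^ 2 ≤ C` is, by definition,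
`Literature.Analysis.FluidPDE.HasBoundedSobolevNormsOn S v` (NSVorticity.lean) written out so that
the route does not import that module; fold/unfold it freely (Iff.rfl).] -/
@[route_item "route-NavierStokesRegularity-ReynoldsMonotone", crux]
def ClassicalContinuation : Prop :=
  ∀ (ν T : ℝ), 0 < ν → 0 < T → ∀ (u : ℝ → EuclideanSpace ℝ (Fin 3) → EuclideanSpace ℝ (Fin 3)) (p : ℝ → EuclideanSpace ℝ (Fin 3) → ℝ), Literature.Analysis.FluidPDE.IsClassicalNSSolutionOn (Set.Ico 0 T) ν 0 u p → Literature.Analysis.FluidPDE.IsLerayHopfOn T ν 0 (u 0) u → Literature.Analysis.FluidPDE.HasRapidSpatialDecay (u 0) → (∃ T' : ℝ, T < T' ∧ ∃ (v : ℝ → EuclideanSpace ℝ (Fin 3) → EuclideanSpace ℝ (Fin 3)) (q : ℝ → EuclideanSpace ℝ (Fin 3) → ℝ), Literature.Analysis.FluidPDE.IsClassicalNSSolutionOn (Set.Icc 0 T') ν 0 v q ∧ (∀ n : ℕ, ∃ C : NNReal, ∀ t ∈ Set.Icc 0 T', ∫⁻ x, ‖iteratedFDeriv ℝ n (v t) x‖ₑ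 ^ 2 ≤ (C : ENNReal)) ∧ Literature.Analysis.FluidPDE.IsLerayHopfOn T' ν 0 (u 0) v ∧ v 0 = u 0) → Literature.Analysis.FluidPDE.HasSmoothExtensionPast ν 0 u T

-- `ClassicalContinuation` holds: proved by `Summit.NavierStokesRegularity.NavierStokesRegularity.Theorems.reynoldsMonotone_classicalContinuation_proof` (its module imports this route file, so no `_holds` link can be stated here).

-- earlier PreEulerAssembly (stmt-NavierStokesRegularity-8679, replaced 2026-08-15T16:15:02Z -> stmt-NavierStokesRegularity-10428): retired by None — PreEulerRegularity → PostEulerRegularity → (∀ (ν T : ℝ), 0 < ν → 0 < T → ∀ (u : ℝ → EuclideanSpace ℝ (Fin 3) → EuclideanSpace ℝ (Fin 3)) (p : ℝ → EuclideanSpace ℝ (Fin 3) → ℝ), Literature.Analysis.FluidPDE.IsClassicalNSSolutionOn (Set.Ico 0 T) ν 0 u p →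
/-- item stmt-NavierStokesRegularity-10428 · support · rank 9 · closed · proved by Summit.NavierStokesRegularity.NavierStokesRegularity.Theorems.reynoldsMonotone_preEulerAssembly_proof (prover) · by planner
sources: Fefferman2000, Constantin1986
[support] glue for the weaker waypoint (pure logic, sorry-free in Sketch.lean
`preEulerAssembly_proof`): PreEulerRegularity → PostEulerRegularity → ClassicalContinuation →
NoBlowupSuffices → NavierStokesRegularity (by contradiction at a putative first singular time T:
PostEuler gives Euler on [0,T], PreEuler gives an NS_ν solution beyond T, ClassicalContinuation
contradicts maximality). [difficulty: provable-now] [rev 4 cone repair: the BKM-class clause `∀ n, ∃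
C, ∀ t ∈ S, ∫⁻ x, ‖iteratedFDeriv ℝ n (v t) x‖ₑ ^ 2 ≤ C` is, by definition,
`Literature.Analysis.FluidPDE.HasBoundedSobolevNormsOn S v` (NSVorticity.lean) written out so that
the route does not import that module; fold/unfold it freely (Iff.rfl).] -/
@[route_item "route-NavierStokesRegularity-ReynoldsMonotone"]
def PreEulerAssembly : Prop :=
  PreEulerRegularity → PostEulerRegularity → (∀ (ν T : ℝ), 0 < ν → 0 < T → ∀ (u : ℝ → EuclideanSpace ℝ (Fin 3) → EuclideanSpace ℝ (Fin 3)) (p : ℝ → EuclideanSpace ℝ (Fin 3) → ℝ), Literature.Analysis.FluidPDE.IsClassicalNSSolutionOn (Set.Ico 0 T) ν 0 u p → Literature.Analysis.FluidPDE.IsLerayHopfOn T ν 0 (u 0) u → Literature.Analysis.FluidPDE.HasRapidSpatialDecay (u 0) → (∃ T' : ℝ, T < T' ∧ ∃ (v : ℝ → EuclideanSpace ℝ (Fin 3) → EuclideanSpace ℝ (Fin 3)) (q : ℝ → EuclideanSpace ℝ (Fin 3) → ℝ), Literature.Analysis.FluidPDE.IsClassicalNSSolutionOn (Set.Icc 0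 T') ν 0 v q ∧ (∀ n : ℕ, ∃ C : NNReal, ∀ t ∈ Set.Icc 0 T', ∫⁻ x, ‖iteratedFDeriv ℝ n (v t) x‖ₑ ^ 2 ≤ (C : ENNReal)) ∧ Literature.Analysis.FluidPDE.IsLerayHopfOn T' ν 0 (u 0) v ∧ v 0 = u 0) → Literature.Analysis.FluidPDE.HasSmoothExtensionPast ν 0 u T) → ((∀ (ν T : ℝ), 0 < ν → 0 < T → ∀ (u : ℝ → EuclideanSpace ℝ (Fin 3) → EuclideanSpace ℝ (Fin 3)) (p : ℝ → EuclideanSpace ℝ (Fin 3) → ℝ), Literature.Analysis.FluidPDE.IsClassicalNSSolutionOn (Set.Ico 0 T) ν 0 u p → Literature.Analysis.FluidPDE.IsLerayHopfOn T ν 0 (u 0) u → Literature.Analysis.FluidPDE.HasRapidSpatialDecay (u 0) → Literature.Analysis.FluidPDE.HasSmoothExtensionPast ν 0 u T) → NavierStokesRegularity) → NavierStokesRegularity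

-- `PreEulerAssembly` holds: proved by `Summit.NavierStokesRegularity.NavierStokesRegularity.Theorems.reynoldsMonotone_preEulerAssembly_proof` (its module imports this route file, so no `_holds` link can be stated here).

-- earlier RayScaling (stmt-NavierStokesRegularity-8680, replaced 2026-08-15T16:15:02Z -> stmt-NavierStokesRegularity-10429): retired by None — ∀ (a ν T : ℝ), 0 < a → 0 < ν → 0 < T → ∀ u₀ : EuclideanSpace ℝ (Fin 3) → EuclideanSpace ℝ (Fin 3), (∃ T' : ℝ, T < T' ∧ ∃ (v : ℝ → EuclideanSpace ℝ (Fin 3) → EuclideanSpace ℝ (Fin 3)) (q : ℝ → EuclideanSpace ℝ (Fin 3) → ℝ), Literature.Analysis.FluidPDE.IsClass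
/-- item stmt-NavierStokesRegularity-10429 · support · rank 9 · closed · proved by Summit.NavierStokesRegularity.NavierStokesRegularity.Theorems.reynoldsMonotone_rayScaling_proof (prover) · by planner
sources: Tao2011, Leray1934, Fefferman2000
[support] the scaling dictionary (card P1, provable now from in-tree
`IsClassicalNSSolutionOn.stRescale` with α = a, γ = 1, β = a and `IsLerayHopfOn.viscosityRescale`):
(s,y) ↦ a·v(a s, y) carries a BKM-class classical Leray–Hopf solution of NS_ν from u₀ beyond T to
one of NS_{aν} from a·u₀ beyond T/a. Hence VM ⇔ monotonicity of blow-up along amplitude rays, and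
ν_c(u₀) := sup of bad ν is 1-homogeneous. [difficulty: provable-now] [rev 4 cone repair: the
BKM-class clause `∀ n, ∃ C, ∀ t ∈ S, ∫⁻ x, ‖iteratedFDeriv ℝ n (v t) x‖ₑ ^ 2 ≤ C` is, by definition,
`Literature.Analysis.FluidPDE.HasBoundedSobolevNormsOn S v` (NSVorticity.lean) written out so that
the route does not import that module; fold/unfold it freely (Iff.rfl).] -/
@[route_item "route-NavierStokesRegularity-ReynoldsMonotone"]
def RayScaling : Prop :=
  ∀ (a ν T : ℝ), 0 < a → 0 < ν → 0 < T → ∀ u₀ : EuclideanSpace ℝ (Fin 3) → EuclideanSpace ℝ (Fin 3), (∃ T' : ℝ, T < T' ∧ ∃ (v : ℝ → EuclideanSpace ℝ (Fin 3) → EuclideanSpace ℝ (Fin 3)) (q : ℝ → EuclideanSpace ℝ (Fin 3) → ℝ), Literature.Analysis.FluidPDE.IsClassicalNSSolutionOn (Set.Icc 0 T') ν 0 v q ∧ (∀ n : ℕ, ∃ C : NNReal, ∀ t ∈ Set.Icc 0 T', ∫⁻ x, ‖iteratedFDeriv ℝ n (v t) x‖ₑ ^ 2 ≤ (C : ENNReal))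 ∧ Literature.Analysis.FluidPDE.IsLerayHopfOn T' ν 0 u₀ v ∧ v 0 = u₀) → (∃ T' : ℝ, T / a < T' ∧ ∃ (v : ℝ → EuclideanSpace ℝ (Fin 3) → EuclideanSpace ℝ (Fin 3)) (q : ℝ → EuclideanSpace ℝ (Fin 3) → ℝ), Literature.Analysis.FluidPDE.IsClassicalNSSolutionOn (Set.Icc 0 T') (a * ν) 0 v q ∧ (∀ n : ℕ, ∃ C : NNReal, ∀ t ∈ Set.Icc 0 T', ∫⁻ x, ‖iteratedFDeriv ℝ n (v t) x‖ₑ ^ 2 ≤ (C : ENNReal)) ∧ Literature.Analysis.FluidPDE.IsLerayHopfOn T' (a * ν) 0 (a • u₀) v ∧ v 0 = a • u₀)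

-- `RayScaling` holds: proved by `Summit.NavierStokesRegularity.NavierStokesRegularity.Theorems.reynoldsMonotone_rayScaling_proof` (its module imports this route file, so no `_holds` link can be stated here).

/-- item stmt-NavierStokesRegularity-8682 · assembly · rank 1 · closed · proved by Summit.NavierStokesRegularity.NavierStokesRegularity.Theorems.reynoldsMonotone_assembly_proof (prover) · by planner
sources: Fefferman2000, Constantin1986, Prodi1959
[assembly] ViscosityMonotone → PostEulerRegularity → ConstantinSmallViscosity →
ClassicalContinuation → NoBlowupSuffices → NavierStokesRegularity. -/
@[route_item "route-NavierStokesRegularity-ReynoldsMonotone"]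
def Assembly : Prop :=
  ViscosityMonotone → PostEulerRegularity → ConstantinSmallViscosity → ClassicalContinuation → NoBlowupSuffices → NavierStokesRegularity

-- `Assembly` holds: proved by `Summit.NavierStokesRegularity.NavierStokesRegularity.Theorems.reynoldsMonotone_assembly_proof` (its module imports this route file, so no `_holds` link can be stated here).

/-! D-0027 §2.1 — DECIDING THEOREM (planner-authored via `route open/edit --closes-file`; by planner-plancard-NavierStokesRegularity-Navie-eeff9292-0 2026-08-15T13:27:08Z):
its hypotheses are this route's items and its conclusion the sub-problem Statement (glue_lint), and it elaborates with this file. -/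

/-- DECIDING THEOREM (D-0027 §2.1): the route's assembly is pure logic — at a putative first
singular time `T`, `PostEulerRegularity` gives a BKM-class Euler solution on `[0,T]` from the same
datum, `ConstantinSmallViscosity` an NS solution beyond `T` at viscosity `min ν ν₀`,
`ViscosityMonotone` lifts it to `ν`, and `ClassicalContinuation` contradicts maximality; then
`NoBlowupSuffices` (= stmt-NavierStokesRegularity-0055) gives Clay (A). -/
@[closes "route-NavierStokesRegularity-ReynoldsMonotone"] theorem closes : ViscosityMonotone → PostEulerRegularity → ConstantinSmallViscosity →
    ClassicalContinuation → NoBlowupSuffices → NavierStokesRegularity := by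
  intro hVM hPost hC hCont hNB
  refine hNB ?_
  intro ν T hν hT u p hcl hLH hdec
  by_contra hne
  obtain ⟨U, P, hE, hB, hU0⟩ := hPost ν T hν hT u p hcl hLH hdec hne
  have hdecU : Literature.Analysis.FluidPDE.HasRapidSpatialDecay (U 0) := hU0 ▸ hdec
  obtain ⟨ν₀, hν₀, hsmall⟩ := hC T hT U P hE hB hdecU
  have h1 := hsmall (min ν ν₀) (lt_min hν hν₀) (min_le_right _ _)
  have hreg := hVM (min ν ν₀) ν T (lt_min hν hν₀) (min_le_left _ _) hT (U 0) hdecU h1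
  rw [hU0] at hreg
  exact hne (hCont ν T hν hT u p hcl hLH hdec hreg)

end Summit.NavierStokesRegularity.NavierStokesRegularity.Theses.ReynoldsMonotone
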